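import Summits.QuantumFields.YangMills.Theorems.BalabanUVNodesN11RunGuardIsCouplingFloor
import Summits.QuantumFields.YangMills.Theorems.BalabanUVNodesK2NamedJetsRunRemAt

/-!
# DAG node N11 × K1⁷ — THE RUN GUARD IN THE K1 ROAD's OWN β-CELL CURRENCY: K2⁷'s run letter `RunRemAt F κ θ h c` + the bare drift `OneLoopDrift` give the run-wise β-ceiling
# `β_n(g_0,…,g_n) ≤ 2c·stepBal + 2|c|A` on some window level `γ₀ ∈ ]0, θ.γ]`; hence (i) `PartCompat₁₃` on every in-window run of the record above the floor
# `log(1∕g_K² + max(2c·stepBal + 2|c|A, 0)) ≤ L^{m−a}`, and (ii) — LOCATED, count-neutral — the ∀-window guard binder `∀ P, window γ → PartCompat₁₃ θ P P.K` is FALSE at EVERY `γ > 0`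
# under exactly the letters the K1 ∃-producer carries

HEADER — WORK-UNIT METADATA.  Cell `pub-ymgap`, YM-PLAN Track A (HUMAN RULING D-0062 ∕ D-0149 width seats), seat `pub-ymgap-dag-n11-w4` (g4; WIDTH SEAT 4 of 4 on NODE n11
[B14]), route `BalabanUVNodes`, item K1⁷ `StabilityBAtRecordR13SepCoPH` = stmt-QuantumFields-20542 (helper lane, `--kind proof --supports 20542 --as helper`, count-neutral).
[I] = [Balaban1987RG1], [III] = [Balaban1988Convergent].  Over this seat's `…N11RunGuardIsCouplingFloor` (g4 INTENT-1: ★★ `partCompat₁₃_of_window_of_betaLeAlongRuns_of_floor`, ★★★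
`not_forall_window_partCompat₁₃_of_betaLe`, `betaLe_of_runConstRemainder`), K2⁷'s `…K2NamedJetsRunRemAt` (p≈598xxx: `RunRemAt`, `RunConstRemainder`, `runRemAt_iff_hPFree`) and
`…K2NamedJetsRemAt` (`band_of_drift`), the tree's `Beta.Drift.OneLoopDrift`.

WHY THIS FILE.  The K1 road of record on N11's chain (dag-n11-d g14 p609050 `…K1CeilingFreeOfSupplyChain` §4, over dag-n24-w1 p598782) carries, in ONE ∃-producer at the witness:
K2⁷'s run letter `RunRemAt F κ θ h c`, the bare drift `OneLoopDrift (stepBal 2 F.L) A (beta0OfJs F κ)`, and N11's chain `hN : ∀ P, window w.γ → SupplyChainAt θ P`; the tree's producers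
of the chain's no-expansion half at the printed level (dag-n11-w1 g2 p607924 ∕ p609410 ∕ p611894 ∕ p613848) display the guard binder `hPC : ∀ P, Step.InInterval γ P.K (gOfRecord₁₃ θ P) →
PartCompat₁₃ θ P P.K` at the printed window's own `γ`.  INTENT-1 showed: a run-wise β-ceiling makes that binder false at every `γ` and makes the guard a floor on `g_K`.  THIS FILE reads
the ceiling OFF THE K1 ROAD's OWN LETTERS — `RunRemAt` gives `|β_k − c·β⁰_k| ≤ s ≤ c·stepBal` along in-window (0.20)-runs at some level `γ₀ ∈ ]0, θ.γ]`, the drift gives the band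
`c·β⁰_k ≤ c·stepBal + 2|c|A` (`band_of_drift`), so `β ≤ 2c·stepBal + 2|c|A` run-wise (§1; the same number p598782 §3 matched against `w.βup`) — and concludes: (i) ★★ the guard on
every in-window (`γ ≤ γ₀`) run of the record above ONE floor on its last coupling (§2); (ii) ★★★ under `RunRemAt` + drift the ∀-window guard binder is FALSE at every `γ > 0`, at
every `θ` with `M = L^a`, `1 ≤ r` — in particular at every H-extension of K1's witness family θ₁₅ᶜᶜᴹᵂ(j; γ) (§3).  So the K1 ∃-producer's β-cell letters CANNOT feed a face that asks the
guard for all runs of the window; on this road the chain's no-expansion half must be produced PER RUN with the guard as an antecedent (def-T's row `bg`, n11-d's faces) or on the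
runs above the floor of §2 — the plan's ∕ K1 lead's call (count-neutral; nothing registered is denied).

NEAREST TREE NEIGHBOUR (cited, not imported): dag-n13-w4's `…K1WindowKOfRunRows` (`windowK_uniform_of_forwardGenerated_of_runConstRemainder` ∕ `…_datumOfRecord₁₃SepCoPH_…`: from
row (i) ALONE, in-window runs of EVERY length with the explicit bare coupling `g₀⁻² = γ⁻² + K·max(B + r, 0)` — the same forward induction as INTENT-1's raw-`genSeq` lemma
`window_genSeq_of_betaLe`); what is NEW here is the USE of such runs: their LAST 𝐃-cube does not fit the torus, so the guard binder is unsatisfiable under the very run rows K1⁷ v6's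
stub 2″ registers.

WHAT THIS FILE PROVES (0 `sorry`, 0 `def`; composition BY NAME + three lines of arithmetic; `RunRemAt` and the drift are HYPOTHESES, inhabited at no θ here).
§1 `const_mul_le_of_drift` (`c·β⁰_k ≤ c·b + 2|c|A` from `OneLoopDrift b A β⁰`) · ★ `betaLe_of_runRemAt_of_drift` (the run-wise ceiling `2c·stepBal + 2|c|A` at some `γ₀ ∈ ]0, θ.γ]`).
§2 ★★ `partCompat₁₃_of_runRemAt_of_drift_of_floor` (θ : Stage13HParams F 2, `θ.τ9.M = F.L^a`, `θ.ν.r = 1`, `a ≤ F.m`).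
§3 ★★★ `not_forall_window_partCompat₁₃_of_runRemAt_of_drift` (`1 ≤ θ.ν.r`) · ★★★ `not_forall_flowWindow_partCompat₁₃_of_runRemAt_of_drift` (the window read off the CoPH datum's
   flow, as the K1 faces write it) · ★★★ `not_forall_window_partCompat₁₃_of_runRemAt_of_drift_of_eq_theta13OfThm1CCMW` (any `θ` with `θ.toStage13Params = θ₁₅ᶜᶜᴹᵂ(j; γ…)`) ·
   β-FREE: ★★★ `not_forall_flowWindow_partCompat₁₃_of_windowClause_of_lt_threshold` (the crux consequent's own window clause `∃ γ₁ > 0, ∀ γ ≤ γ₁, ∃ P, 1 ≤ P.K ∧ window γ P`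
   refutes the binder at every `γ ≤ γ₁` below `exp(−L^{m−a}∕2)`; any `N`).

HONEST FRAMING.  Helper lane of K1⁷; count-neutral kernel bookkeeping; nothing of [I]∕[III] asserted; NOT a discharge, NOT a refutation of any registered statement (§3 denies a
displayed BINDER FAMILY of helper faces under the K1 road's own hypotheses).  N11 NOT discharged; K1⁷ NOT closed; counts unmoved (typed 28∕28 · discharged 5∕27).  R4 closes only the
conditional finite-𝕋⁴ rung `BalabanLadder.UV` of one programme at fixed `ε = L^{−K}` — NOT ℝ⁴, NOT OS, NOT a mass gap, NOT Clay.  No `sorry`, `axiom`, `def`, `instance`, `notation`.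
Sources (SHAPE ∕ bookkeeping only): [I] (0.18)–(0.20) pp.255–256, (0.31) p.259, (1.20)–(1.22) p.264, §1 p.264, (2.12)–(2.14) p.268; [III] (2.1) p.254, (2.5) p.255, p.257.
-/

noncomputable section

namespace Summit.QuantumFields.YangMills.Theorems.BalabanUVNodesN11RunGuardOfRunRemAt

open Literature.MathematicalPhysics.QuantumFieldTheory.Balaban1983to89 T4Continuum Node00
open FlowStep (HBeta RGEqH prefixOf)
open Literature.MathematicalPhysics.QuantumFieldTheory.Balaban1983to89.Beta.Drift (OneLoopDrift)
open Summit.QuantumFields.YangMills.Theorems.BalabanUVNodesK2JsOfRecord (StepColourData beta0OfJs)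
open Summit.QuantumFields.YangMills.Theorems.BalabanUVNodesK2NamedJetsRemAt (band_of_drift)
open Summit.QuantumFields.YangMills.Theorems.BalabanUVNodesK2NamedJetsRunRemAt (RunRemAt RunConstRemainder runRemAt_iff_hPFree)
open BalabanUVNodesN11RunGuardIsCouplingFloor (betaLe_of_runConstRemainder partCompat₁₃_of_window_of_betaLeAlongRuns_of_floor
  not_forall_window_partCompat₁₃_of_betaLe not_forall_window_partCompat₁₃_of_exists_run_of_lt_threshold)

variable {F : T4Family}

/-! ## §1  The run-wise β-ceiling from K2⁷'s run letter and the bare drift -/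

section Ceiling

/-- **THE BAND OF THE SCALED ONE-LOOP NUMBERS**: `OneLoopDrift b A β⁰` (partial sums within `A` of the line `b·k`) gives `|β⁰_k − b| ≤ 2A` (`band_of_drift`), hence
`c·β⁰_k ≤ c·b + 2|c|A` for every real `c`. [cite: Balaban1987RG1, (1.3) p.260 and (1.22) p.264 (bookkeeping)] -/
theorem const_mul_le_of_drift {b A c : ℝ} {β0 : ℕ → ℝ} (h : OneLoopDrift b A β0) (k : ℕ) : c * β0 k ≤ c * b + 2 * (|c| * A) := by
  have hk := band_of_drift h k
  have h2 : c * (β0 k - b) ≤ |c| * |β0 k - b| :=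
    calc c * (β0 k - b) ≤ |c * (β0 k - b)| := le_abs_self _
      _ = |c| * |β0 k - b| := abs_mul _ _
  have h3 : |c| * |β0 k - b| ≤ |c| * (2 * A) := mul_le_mul_of_nonneg_left hk (abs_nonneg c)
  nlinarith

/-- **★ K2⁷'s RUN LETTER + THE BARE DRIFT ⇒ THE RUN-WISE β-CEILING** of the record's β-functions: `RunRemAt F κ θ h c` (∃ `γ₀ ∈ ]0, θ.γ]`, `s ≤ c·stepBal`, `|β_k(g_0..g_k) − c·β⁰_k| ≤ s`
along in-window (0.20)-runs) and `OneLoopDrift (stepBal 2 F.L) A (beta0OfJs F κ)` give, at that `γ₀`, `β_n(g_0,…,g_n) ≤ 2c·stepBal 2 F.L + 2|c|A` at the running end of every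
in-window (0.20)-run — the number p598782 §3 matches against `w.βup`. [cite: Balaban1987RG1, (1.20)–(1.22) p.264, (2.12)–(2.14) p.268, §1 p.264 (bookkeeping)] -/
theorem betaLe_of_runRemAt_of_drift (κ : StepColourData) (θ : Stage13HParams F 2) (hP : θ.Provisos₁₃SepCoPH F 2) {c A : ℝ}
    (hRun : RunRemAt F κ θ hP c) (hdrift : OneLoopDrift (B12Normalization.stepBal 2 F.L) A (beta0OfJs F κ)) :
    ∃ γ₀ : ℝ, 0 < γ₀ ∧ γ₀ ≤ θ.γ ∧
      ∀ (n : ℕ) (gs : ℕ → ℝ), RGEqH n (betaOfRecord₁₃ F 2 θ.toStage13Params) gs → Step.InInterval γ₀ n gs →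
        betaOfRecord₁₃ F 2 θ.toStage13Params n (prefixOf gs n) ≤ 2 * (c * B12Normalization.stepBal 2 F.L) + 2 * (|c| * A) := by
  obtain ⟨γ₀, s, hγ₀, hγθ, hcap, hrem, -, -⟩ := (runRemAt_iff_hPFree F κ θ hP c).1 hRun
  refine ⟨γ₀, hγ₀, hγθ, fun n gs hrg hI => ?_⟩
  have h := betaLe_of_runConstRemainder (fun n gs hrg hI k hk => hrem n gs hrg hI k hk)
    (fun k => const_mul_le_of_drift (c := c) hdrift k) n gs hrg hI
  linarith

end Ceiling

/-! ## §2  The guard on every in-window run of the record above ONE floor on its last coupling, from the K1 road's own β-cell letters -/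

section Positive

/-- **★★ THE RUN GUARD FROM `RunRemAt` + DRIFT + ONE FLOOR** (θ : Stage13HParams F 2 with `θ.τ9.M = F.L^a`, `θ.ν.r = 1`, `a ≤ F.m`): there is a window level `γ₀ ∈ ]0, θ.γ]`
(K2⁷'s) such that every run of the record lying in `]0, γ]`, `γ ≤ γ₀`, up to `K`, whose LAST coupling clears `log(1∕g_K² + max(2c·stepBal + 2|c|A, 0)) ≤ L^{m−a}`, is
partition-compatible up to every `n ≤ K`. [cite: Balaban1987RG1, (0.20) p.256, (0.31) p.259, (1.20)–(1.22) p.264; Balaban1988Convergent, (2.1) p.254, (2.5) p.255, p.257] -/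
theorem partCompat₁₃_of_runRemAt_of_drift_of_floor (κ : StepColourData) (θ : Stage13HParams F 2) (hP : θ.Provisos₁₃SepCoPH F 2)
    {a : ℕ} (hM : θ.τ9.M = F.L ^ a) (hr : θ.ν.r = 1) (ha : a ≤ F.m) {c A : ℝ}
    (hRun : RunRemAt F κ θ hP c) (hdrift : OneLoopDrift (B12Normalization.stepBal 2 F.L) A (beta0OfJs F κ)) :
    ∃ γ₀ : ℝ, 0 < γ₀ ∧ γ₀ ≤ θ.γ ∧ ∀ (p : B12.RunParams) (γ : ℝ), γ ≤ γ₀ →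
      Step.InInterval γ p.K (gOfRecord₁₃ F 2 θ.toStage13Params p) →
      Real.log (1 / gOfRecord₁₃ F 2 θ.toStage13Params p p.K ^ 2 + max (2 * (c * B12Normalization.stepBal 2 F.L) + 2 * (|c| * A)) 0) ≤
          ((F.L ^ (F.m - a) : ℕ) : ℝ) →
      ∀ n, n ≤ p.K → PartCompat₁₃ F 2 θ.toStage13Params p n := by
  obtain ⟨γ₀, hγ₀, hγθ, hB⟩ := betaLe_of_runRemAt_of_drift κ θ hP hRun hdrift
  exact ⟨γ₀, hγ₀, hγθ, fun p γ hγ hW hfloor n hn =>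
    partCompat₁₃_of_window_of_betaLeAlongRuns_of_floor θ.toStage13Params hM hr p ha hγ (le_max_right _ _)
      (fun n gs hrg hI => (hB n gs hrg hI).trans (le_max_left _ _)) hW hfloor hn⟩

end Positive

/-! ## §3  LOCATED: under the K1 road's own β-cell letters the ∀-window guard binder is FALSE at every `γ > 0` -/

section Located

/-- **★★★ UNDER `RunRemAt` + DRIFT THE ∀-WINDOW GUARD BINDER IS FALSE AT EVERY `γ > 0`** (θ : Stage13HParams F 2 with `θ.τ9.M = F.L^a`, `1 ≤ θ.ν.r`; LOCATED, count-neutral):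
the K1 ∃-producer's letters give the run-wise ceiling at some `γ₀ > 0` (§1), and INTENT-1's `not_forall_window_partCompat₁₃_of_betaLe` does the rest (tiny bare couplings stay in
`]0, min γ γ₀]` and leave the level-1 cube bigger than the torus). [cite: Balaban1987RG1, (0.18)–(0.20) pp.255–256, (1.20)–(1.22) p.264, §1 p.264; Balaban1988Convergent, p.257] -/
theorem not_forall_window_partCompat₁₃_of_runRemAt_of_drift (κ : StepColourData) (θ : Stage13HParams F 2) (hP : θ.Provisos₁₃SepCoPH F 2)
    {a : ℕ} (hM : θ.τ9.M = F.L ^ a) (hr : 1 ≤ θ.ν.r) {c A : ℝ}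
    (hRun : RunRemAt F κ θ hP c) (hdrift : OneLoopDrift (B12Normalization.stepBal 2 F.L) A (beta0OfJs F κ)) {γ : ℝ} (hγ : 0 < γ) :
    ¬ ∀ P : B12.RunParams, Step.InInterval γ P.K (gOfRecord₁₃ F 2 θ.toStage13Params P) → PartCompat₁₃ F 2 θ.toStage13Params P P.K := by
  obtain ⟨γ₀, hγ₀, -, hB⟩ := betaLe_of_runRemAt_of_drift κ θ hP hRun hdrift
  exact not_forall_window_partCompat₁₃_of_betaLe θ.toStage13Params hM hr hγ₀ hB hγ

/-- **★★★ THE SAME WITH THE WINDOW READ OFF THE CoPH DATUM's FLOW** (as the K1 faces write it: `((datumOfRecord₁₃SepCoPH F 2 θ h).C P).flow.InInterval γ P.K`; that flow's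
couplings ARE `gOfRecord₁₃ θ P`, `rfl`). [cite: Balaban1987RG1, (0.18)–(0.20) pp.255–256, (1.20)–(1.22) p.264; Balaban1988Convergent, p.257] -/
theorem not_forall_flowWindow_partCompat₁₃_of_runRemAt_of_drift (κ : StepColourData) (θ : Stage13HParams F 2) (hP : θ.Provisos₁₃SepCoPH F 2)
    {a : ℕ} (hM : θ.τ9.M = F.L ^ a) (hr : 1 ≤ θ.ν.r) {c A : ℝ}
    (hRun : RunRemAt F κ θ hP c) (hdrift : OneLoopDrift (B12Normalization.stepBal 2 F.L) A (beta0OfJs F κ)) {γ : ℝ} (hγ : 0 < γ) :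
    ¬ ∀ P : B12.RunParams, ((datumOfRecord₁₃SepCoPH F 2 θ hP).C P).flow.InInterval γ P.K → PartCompat₁₃ F 2 θ.toStage13Params P P.K :=
  fun h => not_forall_window_partCompat₁₃_of_runRemAt_of_drift κ θ hP hM hr hRun hdrift hγ fun P hW => h P fun k hk => hW k hk

/-- **★★★ AT EVERY H-EXTENSION OF K1's WITNESS FAMILY θ₁₅ᶜᶜᴹᵂ(j; γᶜ…)** (`θ.toStage13Params = theta13OfThm1CCMW …`: `M = L^j`, `r = 1` by dag-n21-c's `rfl` letters): under
`RunRemAt` + drift the ∀-window guard binder is FALSE at every `γ > 0` (LOCATED, count-neutral). [cite: Balaban1987RG1, (0.20) p.256, (1.20)–(1.22) p.264; Balaban1988Convergent, p.257; Balaban1989LargeFieldI, (2.1) p.182] -/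
theorem not_forall_window_partCompat₁₃_of_runRemAt_of_drift_of_eq_theta13OfThm1CCMW (κ : StepColourData) (θ : Stage13HParams F 2)
    (hP : θ.Provisos₁₃SepCoPH F 2) {j : ℕ} {γc ε₀ ε₂₉ B₃ B₃' a₀ a₁ : ℝ} (hθ : θ.toStage13Params = theta13OfThm1CCMW F 2 j γc ε₀ ε₂₉ B₃ B₃' a₀ a₁)
    {c A : ℝ} (hRun : RunRemAt F κ θ hP c) (hdrift : OneLoopDrift (B12Normalization.stepBal 2 F.L) A (beta0OfJs F κ)) {γ : ℝ} (hγ : 0 < γ) :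
    ¬ ∀ P : B12.RunParams, Step.InInterval γ P.K (gOfRecord₁₃ F 2 θ.toStage13Params P) → PartCompat₁₃ F 2 θ.toStage13Params P P.K := by
  have hM : θ.toStage13Params.τ9.M = F.L ^ j := by rw [hθ]; exact theta13OfThm1CCMW_τ9_M F 2 j γc ε₀ ε₂₉ B₃ B₃' a₀ a₁
  have hr : 1 ≤ θ.toStage13Params.ν.r := by rw [hθ, theta13OfThm1CCMW_r]
  exact not_forall_window_partCompat₁₃_of_runRemAt_of_drift κ θ hP hM hr hRun hdrift hγ

/-- **★★★ β-FREE, IN THE CRUX's OWN LETTERS: THE WINDOW CLAUSE OF K1⁷'s CONSEQUENT REFUTES THE ∀-WINDOW GUARD BINDER BELOW THE THRESHOLD** (θ : Stage13HParams F N with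
`θ.τ9.M = F.L^a`, `θ.ν.r = 1`; LOCATED, count-neutral): if the last conjunct of `StabilityBAtRecordR13SepCoPH`'s consequent holds at `(θ, h)` — `∃ γ₁ > 0, ∀ γ ∈ ]0, γ₁], ∃ P, 1 ≤ P.K ∧
((datumOfRecord₁₃SepCoPH θ h).C P).flow.InInterval γ P.K` — then for every `γ ∈ ]0, γ₁]` below `exp(−L^{m−a}∕2)` the binder `∀ P, (datum window γ at P) → PartCompat₁₃ θ P P.K` is FALSE
(INTENT-1's `not_forall_window_partCompat₁₃_of_exists_run_of_lt_threshold`; the datum's couplings ARE `gOfRecord₁₃ θ P`, `rfl`).  No β-letter.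
[cite: Balaban1989LargeFieldII, Thm 1 p.355 (one-sided window); Balaban1988Convergent, p.257; Balaban1987RG1, Thm 1 p.259] -/
theorem not_forall_flowWindow_partCompat₁₃_of_windowClause_of_lt_threshold {N : ℕ} [NeZero N] (θ : Stage13HParams F N) (hP : θ.Provisos₁₃SepCoPH F N)
    {a : ℕ} (hM : θ.τ9.M = F.L ^ a) (hr : θ.ν.r = 1) {γ₁ : ℝ}
    (hwin : ∀ γ : ℝ, 0 < γ → γ ≤ γ₁ → ∃ P : B12.RunParams, 1 ≤ P.K ∧ ((datumOfRecord₁₃SepCoPH F N θ hP).C P).flow.InInterval γ P.K)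
    {γ : ℝ} (hγ : 0 < γ) (hγ₁ : γ ≤ γ₁) (hγt : γ < Real.exp (-((F.L ^ (F.m - a) : ℕ) : ℝ) / 2)) :
    ¬ ∀ P : B12.RunParams, ((datumOfRecord₁₃SepCoPH F N θ hP).C P).flow.InInterval γ P.K → PartCompat₁₃ F N θ.toStage13Params P P.K := by
  intro h
  obtain ⟨P, hK, hW⟩ := hwin γ hγ hγ₁
  exact not_forall_window_partCompat₁₃_of_exists_run_of_lt_threshold θ.toStage13Params hM hr hγt ⟨P, hK, fun k hk => hW k hk⟩
    fun Q hWQ => h Q fun k hk => hWQ k hk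

end Located

end Summit.QuantumFields.YangMills.Theorems.BalabanUVNodesN11RunGuardOfRunRemAt

end
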